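import Literature.MathematicalPhysics.QuantumLattice.TorusSectorGibbsOpenBoxBound
import HarnessLib

/-!
# Open boxes with MIXED particle numbers tile the torus: the canonical free energy of the `t–t'` Hubbard
# torus lies below the CHORD of two box free energies at EVERY filling between the box densities
# (finite volume, `O(1)` defect)

Family `hubbard` (topic `MathematicalPhysics/QuantumLattice`; companion of `TorusSectorPartitionFnTiling`
(torus ≥ product of open boxes with arbitrary block sectors) and `TorusSectorGibbsOpenBoxBound` (the producer
at COMMENSURATE fillings `halfRectN n L = K² a₀`, i.e. `n = 2a₀/a²` only); its thermodynamic-limit consumers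
are in `TorusSectorGibbsFillingBoxFreeEnergy`). Written for the FILLING leg of the material-oracle interface
BOX → WORD at positive temperature (Hubbard programme, stage S1/S2 (iii), the phase map's `T × n` cells): a
downfolded material arrives with a filling INTERVAL `n ∈ [n₁, n₂]` (`n = 1 − x ± δ`), never a commensurate
point, and the thermal certificates must bind the canonical sector at every density of that interval.

THE METHOD is Ruelle's sub-box argument with DIFFERENT particle numbers in different sub-boxes (the source of
the convexity of the canonical free energy in the density): tile the `Ka × Ka` torus by `K²` open `a × a`
boxes, `K² − m` of them carrying `p` electrons per spin and `m` of them `q`. The graded product of the box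
Gibbs states is a trial state of the torus in the sector with `(K² − m)p + mq` electrons per spin, so
(`prod_partitionFn_openBox_le_rectTorus` of the tree)

* §1 `pow_mul_pow_partitionFn_openBox_le_rectTorus`:
  `Re Z_β(box; q,q)^m · Re Z_β(box; p,p)^{K²−m} ≤ Re Z_β(torus_{Ka}; (K²−m)p+mq, (K²−m)p+mq)` (`β ≥ 0`, `K ≥ 2`,
  `m ≤ K²`), and its logarithmic (free-energy) form `mul_log_add_mul_log_partitionFn_openBox_le_rectTorus`;
* §2 with `q = p + 1` EVERY sector `k ∈ [K²p, K²(p+1)]` is of this form, and for a filling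
  `n ∈ [2p/a², 2(p+1)/a²]` the canonical sector of the torus-limit thermal convention `k = halfRectN n (Ka) =
  ⌊n K²a²/2⌋` lies in that range (`sq_mul_le_halfRectN_of_le`, `halfRectN_le_sq_mul_of_le`) with
  `0 ≤ nL²/2 − k < 1` (`halfRectN_floor_bounds`);
* §3 hence (`mul_log_add_mul_log_openBox_le_log_partitionFn_sectorHamiltonianTT'`) with `d = k − K²p ≤ K²`:
  `d·log Re Z_β(box; p+1,p+1) + (K²−d)·log Re Z_β(box; p,p) ≤ log Re Z_β(sectorHamiltonianTT' t t' U n L)`, and,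
  for certified box floors `0 < z_p ≤ Re Z_β(box; p,p)`, `0 < z_q ≤ Re Z_β(box; p+1,p+1)` and every `L = Ka`,
  **`chord_mul_sq_sub_abs_le_log_partitionFn_sectorHamiltonianTT'`**:
  `chord(n)·L² − |log z_q − log z_p| ≤ log Re Z_β(sectorHamiltonianTT' t t' U n L)`,
  `chord(n) = (log z_p + λ(n)(log z_q − log z_p))/a²`, `λ(n) = n a²/2 − p ∈ [0,1]`
  — per site the canonical free energy of the torus lies below the CHORD of the two box free energies at
  every filling of the interval, with an `O(1)` (not `O(L²)`) defect (`d/K²` is `λ(n)` up to `1/K²`); the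
  interval-uniform coarse form is `min(log z_p, log z_q)/a² ≤ chord(n)` (`min_log_div_sq_le_chord`).

HONEST SCOPE: a transport/producer lemma at finite volume — no number, no certificate; no thermodynamic-limit
free-energy FUNCTION is constructed (its existence and convexity in `n`, Ruelle's Theorem 3.4.4, are not
claimed); the chord is between two BOX free energies, which are upper bounds. Everything is PROVED; no
definition, no named fact.

## References

* D. Ruelle, *Statistical Mechanics: Rigorous Results* (1969), §3.3 eqs. (3.11), (3.16)–(3.18) (sub-boxes
  with different particle numbers; interpolation in the density), §3.4.3 eqs. (4.12)–(4.15) (the canonical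
  free energy, convex in `ρ`). [cite: Ruelle1969, §3.3 (3.11), (3.16)–(3.18); §3.4.3]
* R. B. Israel, *Convexity in the Theory of Lattice Gases* (1979), Lemma II.3.1 (finite-volume variational
  principle for quantum lattice systems). [cite: Israel1979, Lemma II.3.1]
* J. P. F. LeBlanc et al., Phys. Rev. X 5 (2015) 041041, eq. (1) (the `t–t'–U` model on clusters at fixed
  density). [cite: LeBlancEtAl2015, eq. (1)]

## Mathlib / tree search

REUSED: `prod_partitionFn_openBox_le_rectTorus`, `partitionFn_spinSector_re_pos`, `nonempty_spinConfig`
(`TorusSectorPartitionFnTiling`); `partitionFn_spinSector_hubbardTorusTT'_eq_rect`,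
`partitionFn_sectorHamiltonianTT'_eq_spinSector` (`TorusSectorGibbsOpenBoxBound`); `halfRectN`, `card_rectSites`,
`hubbardOpenBoxTT'_isHermitian`; Mathlib `Finset.exists_subset_card_eq`, `Finset.prod_mul_prod_compl`,
`Fintype.prod_prod_type'`, `Nat.floor_le_floor`.
`lean search 'halfRectN'`: only the commensurate bookkeeping `halfRectN_seven_eighths_four_mul` exists.
-/

noncomputable section

namespace Literature.MathematicalPhysics.QuantumLattice

open Matrix Finset HubbardWave0 ThermodynamicLimit LiebThm1
open scoped ComplexOrder BigOperators

/-! ### §1 Mixed tiling: two box sectors, finite volume -/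

section MixedTiling

/-- **Open boxes with two different particle numbers tile the torus** (Ruelle's sub-box argument with
mixed particle numbers; canonical `t–t'` Hubbard torus `Ka × Ka`, `K ≥ 2`, `β ≥ 0`): for box sectors
`(p, p)` and `(q, q)` and every `m ≤ K²`,
`Re Z_β(box; q,q)^m · Re Z_β(box; p,p)^{K²−m} ≤ Re Z_β(torus; (K²−m)p + mq, (K²−m)p + mq)`,
`box = hubbardOpenBoxTT' a a t t' U`, `torus = hubbardRectTorusTT' (Ka) (Ka) t t' U`.
[cite: Ruelle1969, §3.3 (3.11), (3.16)–(3.18)] -/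
theorem pow_mul_pow_partitionFn_openBox_le_rectTorus (a K : ℕ) (hK : 2 ≤ K) (t t' U : ℝ) {β : ℝ}
    (hβ : 0 ≤ β) (p q : ℕ) {m : ℕ} (hm : m ≤ K * K) :
    (partitionFn β (spinSectorHamiltonian q q (hubbardOpenBoxTT' a a t t' U))).re ^ m *
        (partitionFn β (spinSectorHamiltonian p p (hubbardOpenBoxTT' a a t t' U))).re ^ (K * K - m) ≤
      (partitionFn β (spinSectorHamiltonian ((K * K - m) * p + m * q) ((K * K - m) * p + m * q)
        (hubbardRectTorusTT' (K * a) (K * a) t t' U))).re := by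
  classical
  obtain ⟨s, -, hs⟩ : ∃ s : Finset (Fin K × Fin K), s ⊆ univ ∧ s.card = m :=
    Finset.exists_subset_card_eq (by rw [Finset.card_univ, Fintype.card_prod, Fintype.card_fin]; exact hm)
  set as : Fin K → Fin K → ℕ := fun i j => if (i, j) ∈ s then q else p with has
  have h := prod_partitionFn_openBox_le_rectTorus a a K K hK hK t t' U hβ as as
  have hcardc : sᶜ.card = K * K - m := by
    rw [Finset.card_compl, Fintype.card_prod, Fintype.card_fin, hs]
  have has_mem : ∀ x ∈ s, as x.1 x.2 = q := fun x hx => by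
    simp only [has, if_pos hx]
  have has_nmem : ∀ x ∈ sᶜ, as x.1 x.2 = p := fun x hx => by
    simp only [has, if_neg (Finset.mem_compl.mp hx)]
  -- the block sectors add up to `(K² − m) p + m q`
  have hsum : (∑ i, ∑ j, as i j) = (K * K - m) * p + m * q := by
    rw [← Fintype.sum_prod_type', ← Finset.sum_add_sum_compl s]
    rw [Finset.sum_congr rfl has_mem, Finset.sum_congr rfl has_nmem, Finset.sum_const, Finset.sum_const,
      smul_eq_mul, smul_eq_mul, hs, hcardc]
    ring
  -- the block partition functions multiply to `Z_q^m · Z_p^{K²−m}`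
  have hprod : (∏ i, ∏ j, (partitionFn β (spinSectorHamiltonian (as i j) (as i j)
      (hubbardOpenBoxTT' a a t t' U))).re) =
      (partitionFn β (spinSectorHamiltonian q q (hubbardOpenBoxTT' a a t t' U))).re ^ m *
        (partitionFn β (spinSectorHamiltonian p p (hubbardOpenBoxTT' a a t t' U))).re ^ (K * K - m) := by
    rw [← Fintype.prod_prod_type' (f := fun i j => (partitionFn β (spinSectorHamiltonian (as i j) (as i j)
      (hubbardOpenBoxTT' a a t t' U))).re), ← Finset.prod_mul_prod_compl s]
    have h1 : ∏ x ∈ s, (partitionFn β (spinSectorHamiltonian (as x.1 x.2) (as x.1 x.2)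
        (hubbardOpenBoxTT' a a t t' U))).re =
        ∏ x ∈ s, (partitionFn β (spinSectorHamiltonian q q (hubbardOpenBoxTT' a a t t' U))).re :=
      Finset.prod_congr rfl fun x hx => by rw [has_mem x hx]
    have h2 : ∏ x ∈ sᶜ, (partitionFn β (spinSectorHamiltonian (as x.1 x.2) (as x.1 x.2)
        (hubbardOpenBoxTT' a a t t' U))).re =
        ∏ x ∈ sᶜ, (partitionFn β (spinSectorHamiltonian p p (hubbardOpenBoxTT' a a t t' U))).re :=
      Finset.prod_congr rfl fun x hx => by rw [has_nmem x hx]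
    rw [h1, h2, Finset.prod_const, Finset.prod_const, hs, hcardc]
  rw [hprod, hsum] at h
  exact h

/-- **Logarithmic (free-energy) form of the mixed tiling**, nonempty box sectors `p, q ≤ a²`:
`m·log Re Z_β(box; q,q) + (K²−m)·log Re Z_β(box; p,p) ≤ log Re Z_β(torus; (K²−m)p+mq, (K²−m)p+mq)`.
[cite: Ruelle1969, §3.3 (3.11), (3.16)–(3.18)] [cite: Israel1979, Lemma II.3.1] -/
theorem mul_log_add_mul_log_partitionFn_openBox_le_rectTorus (a K : ℕ) (hK : 2 ≤ K) (t t' U : ℝ)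
    {β : ℝ} (hβ : 0 ≤ β) {p q : ℕ} (hp : p ≤ a * a) (hq : q ≤ a * a) {m : ℕ} (hm : m ≤ K * K) :
    (m : ℝ) * Real.log (partitionFn β (spinSectorHamiltonian q q (hubbardOpenBoxTT' a a t t' U))).re +
        ((K * K - m : ℕ) : ℝ) *
          Real.log (partitionFn β (spinSectorHamiltonian p p (hubbardOpenBoxTT' a a t t' U))).re ≤
      Real.log (partitionFn β (spinSectorHamiltonian ((K * K - m) * p + m * q) ((K * K - m) * p + m * q)
        (hubbardRectTorusTT' (K * a) (K * a) t t' U))).re := by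
  haveI : Nonempty (Subtype (spinConfig (Λ := Fin a ×ₗ Fin a) p p)) :=
    nonempty_spinConfig (by rw [card_rectSites]; exact hp) (by rw [card_rectSites]; exact hp)
  haveI : Nonempty (Subtype (spinConfig (Λ := Fin a ×ₗ Fin a) q q)) :=
    nonempty_spinConfig (by rw [card_rectSites]; exact hq) (by rw [card_rectSites]; exact hq)
  have hp0 : 0 < (partitionFn β (spinSectorHamiltonian p p (hubbardOpenBoxTT' a a t t' U))).re :=
    partitionFn_spinSector_re_pos (hubbardOpenBoxTT'_isHermitian a a t t' U) β
  have hq0 : 0 < (partitionFn β (spinSectorHamiltonian q q (hubbardOpenBoxTT' a a t t' U))).re :=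
    partitionFn_spinSector_re_pos (hubbardOpenBoxTT'_isHermitian a a t t' U) β
  have h := pow_mul_pow_partitionFn_openBox_le_rectTorus a K hK t t' U hβ p q hm
  have hlog := Real.log_le_log (mul_pos (pow_pos hq0 _) (pow_pos hp0 _)) h
  rw [Real.log_mul (pow_pos hq0 _).ne' (pow_pos hp0 _).ne', Real.log_pow, Real.log_pow] at hlog
  exact hlog

end MixedTiling

/-! ### §2 Filling-interval bookkeeping: the sector of a filling between two box densities -/

section Bookkeeping

/-- For `L = Ka` (`a ≥ 1`) and `2p/a² ≤ n`: `K²p ≤ halfRectN n L` — at a filling above the box density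
`2p/a²` the canonical torus sector holds at least `p` electrons per spin and box. [cite: LeBlancEtAl2015, eq. (1)] -/
theorem sq_mul_le_halfRectN_of_le {a p K L : ℕ} (ha : 1 ≤ a) (hL : L = K * a) {n : ℝ}
    (hn : 2 * (p : ℝ) / (a : ℝ) ^ 2 ≤ n) : K * K * p ≤ halfRectN n L := by
  unfold halfRectN
  refine Nat.le_floor ?_
  have ha0 : (0 : ℝ) < (a : ℝ) := by exact_mod_cast ha
  have ha' : (0 : ℝ) < (a : ℝ) ^ 2 := by positivity
  rw [div_le_iff₀ ha'] at hn
  rw [hL]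
  push_cast
  have hK2 : (0 : ℝ) ≤ (K : ℝ) ^ 2 := sq_nonneg _
  have key : (K : ℝ) ^ 2 * (2 * p) ≤ (K : ℝ) ^ 2 * (n * (a : ℝ) ^ 2) := mul_le_mul_of_nonneg_left hn hK2
  have e1 : (K : ℝ) * K * p = (K : ℝ) ^ 2 * (2 * p) / 2 := by ring
  have e2 : n * ((K : ℝ) * a) ^ 2 / 2 = (K : ℝ) ^ 2 * (n * (a : ℝ) ^ 2) / 2 := by ring
  rw [e1, e2]
  exact div_le_div_of_nonneg_right key (by norm_num)

/-- For `L = Ka` (`a ≥ 1`), `0 ≤ n ≤ 2q/a²`: `halfRectN n L ≤ K²q` — at a filling below the box density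
`2q/a²` the canonical torus sector holds at most `q` electrons per spin and box. [cite: LeBlancEtAl2015, eq. (1)] -/
theorem halfRectN_le_sq_mul_of_le {a q K L : ℕ} (ha : 1 ≤ a) (hL : L = K * a) {n : ℝ}
    (hn : n ≤ 2 * (q : ℝ) / (a : ℝ) ^ 2) : halfRectN n L ≤ K * K * q := by
  unfold halfRectN
  have ha0 : (0 : ℝ) < (a : ℝ) := by exact_mod_cast ha
  have ha' : (0 : ℝ) < (a : ℝ) ^ 2 := by positivity
  rw [le_div_iff₀ ha'] at hn
  have hK2 : (0 : ℝ) ≤ (K : ℝ) ^ 2 := sq_nonneg _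
  have key : (K : ℝ) ^ 2 * (n * (a : ℝ) ^ 2) ≤ (K : ℝ) ^ 2 * (2 * q) := mul_le_mul_of_nonneg_left hn hK2
  have hle : n * (L : ℝ) ^ 2 / 2 ≤ ((K * K * q : ℕ) : ℝ) := by
    rw [hL]
    push_cast
    have e1 : n * ((K : ℝ) * a) ^ 2 / 2 = (K : ℝ) ^ 2 * (n * (a : ℝ) ^ 2) / 2 := by ring
    have e2 : (K : ℝ) * K * q = (K : ℝ) ^ 2 * (2 * q) / 2 := by ring
    rw [e1, e2]
    exact div_le_div_of_nonneg_right key (by norm_num)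
  calc ⌊n * (L : ℝ) ^ 2 / 2⌋₊ ≤ ⌊((K * K * q : ℕ) : ℝ)⌋₊ := Nat.floor_le_floor hle
    _ = K * K * q := Nat.floor_natCast _

/-- A filling between two box densities is a filling: `2p/a² ≤ n ≤ 2(p+1)/a²`, `p + 1 ≤ a²`, `a ≥ 1` give
`0 ≤ n ≤ 2` (cluster/filling bookkeeping of the `t–t'–U` cluster studies). [cite: LeBlancEtAl2015, eq. (1)] -/
theorem filling_bounds_of_box_interval {a p : ℕ} (ha : 1 ≤ a) (hp : p + 1 ≤ a * a) {n : ℝ}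
    (hlo : 2 * (p : ℝ) / (a : ℝ) ^ 2 ≤ n) (hhi : n ≤ 2 * ((p : ℝ) + 1) / (a : ℝ) ^ 2) : 0 ≤ n ∧ n ≤ 2 := by
  have ha0 : (0 : ℝ) < (a : ℝ) := by exact_mod_cast ha
  have ha' : (0 : ℝ) < (a : ℝ) ^ 2 := by positivity
  refine ⟨le_trans (by positivity) hlo, hhi.trans ?_⟩
  rw [div_le_iff₀ ha']
  have : ((p : ℝ) + 1) ≤ (a : ℝ) ^ 2 := by
    have := hp; rw [sq]; exact_mod_cast this
  linarith

/-- The sector number and its real value differ from `n L²/2` by less than one: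
`0 ≤ n L²/2 − halfRectN n L < 1` (`0 ≤ n`; the sector `N = ⌊nL²⌋`-type bookkeeping of fixed-density
cluster studies). [cite: LeBlancEtAl2015, eq. (1)] -/
theorem halfRectN_floor_bounds {n : ℝ} (hn : 0 ≤ n) (L : ℕ) :
    0 ≤ n * (L : ℝ) ^ 2 / 2 - (halfRectN n L : ℝ) ∧ n * (L : ℝ) ^ 2 / 2 - (halfRectN n L : ℝ) < 1 := by
  unfold halfRectN
  have h0 : 0 ≤ n * (L : ℝ) ^ 2 / 2 := by positivity
  refine ⟨sub_nonneg.mpr (Nat.floor_le h0), ?_⟩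
  have := Nat.lt_floor_add_one (n * (L : ℝ) ^ 2 / 2)
  linarith

end Bookkeeping

/-! ### §3 The chord bound at every filling of the interval (finite volume, `O(1)` defect) -/

section Chord

/-- **The mixed-tiling free-energy bound at an arbitrary filling of the box interval, finite volume.**
`L = Ka`, `K ≥ 2`, `p + 1 ≤ a²`, `2p/a² ≤ n ≤ 2(p+1)/a²`; then with `d = halfRectN n L − K²p ≤ K²`,
`d·log Re Z_β(box; p+1,p+1) + (K²−d)·log Re Z_β(box; p,p) ≤ log Re Z_β(sectorHamiltonianTT' t t' U n L)`.
[cite: Ruelle1969, §3.3 (3.11), (3.16)–(3.18)] [cite: Israel1979, Lemma II.3.1] -/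
theorem mul_log_add_mul_log_openBox_le_log_partitionFn_sectorHamiltonianTT' (t t' U : ℝ) {β : ℝ}
    (hβ : 0 ≤ β) {a p K L : ℕ} (ha : 1 ≤ a) (hK : 2 ≤ K) (hL : L = K * a) (hp : p + 1 ≤ a * a) {n : ℝ}
    (hlo : 2 * (p : ℝ) / (a : ℝ) ^ 2 ≤ n) (hhi : n ≤ 2 * ((p : ℝ) + 1) / (a : ℝ) ^ 2) :
    K * K * p ≤ halfRectN n L ∧ halfRectN n L - K * K * p ≤ K * K ∧
      ((halfRectN n L - K * K * p : ℕ) : ℝ) *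
            Real.log (partitionFn β (spinSectorHamiltonian (p + 1) (p + 1) (hubbardOpenBoxTT' a a t t' U))).re +
          ((K * K - (halfRectN n L - K * K * p) : ℕ) : ℝ) *
            Real.log (partitionFn β (spinSectorHamiltonian p p (hubbardOpenBoxTT' a a t t' U))).re ≤
        Real.log (partitionFn β (sectorHamiltonianTT' t t' U n L)).re := by
  have hklo : K * K * p ≤ halfRectN n L := sq_mul_le_halfRectN_of_le ha hL hlo
  have hkhi : halfRectN n L ≤ K * K * (p + 1) :=
    halfRectN_le_sq_mul_of_le ha hL (by push_cast; exact hhi)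
  obtain ⟨d, hd⟩ := Nat.exists_eq_add_of_le hklo
  have hdle : d ≤ K * K := by
    have h1 : K * K * p + d ≤ K * K * p + K * K := by
      calc K * K * p + d = halfRectN n L := hd.symm
        _ ≤ K * K * (p + 1) := hkhi
        _ = K * K * p + K * K := by ring
    exact Nat.le_of_add_le_add_left h1
  have hdsub : halfRectN n L - K * K * p = d := by rw [hd, Nat.add_sub_cancel_left]
  refine ⟨hklo, by rw [hdsub]; exact hdle, ?_⟩
  rw [hdsub]
  have hsec : (K * K - d) * p + d * (p + 1) = halfRectN n L := by
    have h1 : K * K - d + d = K * K := Nat.sub_add_cancel hdle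
    calc (K * K - d) * p + d * (p + 1) = (K * K - d + d) * p + d := by ring
      _ = K * K * p + d := by rw [h1]
      _ = halfRectN n L := hd.symm
  have h := mul_log_add_mul_log_partitionFn_openBox_le_rectTorus a K hK t t' U hβ
    (p := p) (q := p + 1) (by omega) hp hdle
  rw [partitionFn_sectorHamiltonianTT'_eq_spinSector, partitionFn_spinSector_hubbardTorusTT'_eq_rect,
    ← hsec, hL]
  exact h

/-- **The canonical torus free energy lies below the CHORD of two box free energies at every filling of
the interval, finite volume, `O(1)` defect.** `L = Ka`, `K ≥ 2`, `p + 1 ≤ a²`, `2p/a² ≤ n ≤ 2(p+1)/a²`,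
certified box floors `0 < z_p ≤ Re Z_β(box; p,p)`, `0 < z_q ≤ Re Z_β(box; p+1,p+1)`; then with the chord
parameter `λ = n a²/2 − p ∈ [0,1]`:
`(log z_p + λ(log z_q − log z_p))/a² · L² − |log z_q − log z_p| ≤ log Re Z_β(sectorHamiltonianTT' t t' U n L)`.
[cite: Ruelle1969, §3.3 (3.11), (3.16)–(3.18)] [cite: Israel1979, Lemma II.3.1] -/
theorem chord_mul_sq_sub_abs_le_log_partitionFn_sectorHamiltonianTT' (t t' U : ℝ) {β : ℝ} (hβ : 0 ≤ β)
    {a p K L : ℕ} (ha : 1 ≤ a) (hK : 2 ≤ K) (hL : L = K * a) (hp : p + 1 ≤ a * a) {n : ℝ}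
    (hlo : 2 * (p : ℝ) / (a : ℝ) ^ 2 ≤ n) (hhi : n ≤ 2 * ((p : ℝ) + 1) / (a : ℝ) ^ 2)
    {zp zq : ℝ} (hzp0 : 0 < zp)
    (hzp : zp ≤ (partitionFn β (spinSectorHamiltonian p p (hubbardOpenBoxTT' a a t t' U))).re)
    (hzq0 : 0 < zq)
    (hzq : zq ≤ (partitionFn β (spinSectorHamiltonian (p + 1) (p + 1) (hubbardOpenBoxTT' a a t t' U))).re) :
    (Real.log zp + (n * (a : ℝ) ^ 2 / 2 - p) * (Real.log zq - Real.log zp)) / (a : ℝ) ^ 2 * (L : ℝ) ^ 2 -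
        |Real.log zq - Real.log zp| ≤
      Real.log (partitionFn β (sectorHamiltonianTT' t t' U n L)).re := by
  obtain ⟨hklo, hdle, h⟩ := mul_log_add_mul_log_openBox_le_log_partitionFn_sectorHamiltonianTT' t t' U hβ
    ha hK hL hp hlo hhi
  set d := halfRectN n L - K * K * p with hd
  have hn0 : 0 ≤ n := le_trans (by positivity) hlo
  have ha0 : (0 : ℝ) < (a : ℝ) := by exact_mod_cast ha
  have ha2 : (a : ℝ) ^ 2 ≠ 0 := by positivity
  -- the real value of the sector number
  have hkR : ((halfRectN n L : ℕ) : ℝ) = (K : ℝ) * K * p + d := by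
    have : halfRectN n L = K * K * p + d := by rw [hd]; omega
    rw [this]; push_cast; ring
  obtain ⟨hδ0, hδ1⟩ := halfRectN_floor_bounds hn0 L
  -- abbreviations
  set x := Real.log zp with hx
  set y := Real.log zq with hy
  have hxle : x ≤ Real.log (partitionFn β (spinSectorHamiltonian p p (hubbardOpenBoxTT' a a t t' U))).re :=
    Real.log_le_log hzp0 hzp
  have hyle : y ≤
      Real.log (partitionFn β (spinSectorHamiltonian (p + 1) (p + 1) (hubbardOpenBoxTT' a a t t' U))).re :=
    Real.log_le_log hzq0 hzq
  have hcoef : ((K * K - d : ℕ) : ℝ) = (K : ℝ) * K - d := by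
    rw [Nat.cast_sub hdle]; push_cast; ring
  rw [hcoef] at h
  have hKd : (0 : ℝ) ≤ (K : ℝ) * K - d := by
    have : ((d : ℕ) : ℝ) ≤ ((K * K : ℕ) : ℝ) := by exact_mod_cast hdle
    push_cast at this; linarith
  -- monotonicity: replace the box partition functions by their certified floors
  have hmono : (d : ℝ) * y + ((K : ℝ) * K - d) * x ≤
      Real.log (partitionFn β (sectorHamiltonianTT' t t' U n L)).re :=
    le_trans (add_le_add (mul_le_mul_of_nonneg_left hyle (Nat.cast_nonneg d))
      (mul_le_mul_of_nonneg_left hxle hKd)) h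
  -- the chord: `chord·L² = K²x + (nL²/2 − K²p)(y − x)`
  have hchord : (x + (n * (a : ℝ) ^ 2 / 2 - p) * (y - x)) / (a : ℝ) ^ 2 * (L : ℝ) ^ 2 =
      (K : ℝ) * K * x + (n * (L : ℝ) ^ 2 / 2 - (K : ℝ) * K * p) * (y - x) := by
    rw [hL]; push_cast; field_simp
  -- the defect: `(nL²/2 − k)(y − x) ≤ |y − x|` since `0 ≤ nL²/2 − k < 1`
  have hdef : (n * (L : ℝ) ^ 2 / 2 - (halfRectN n L : ℝ)) * (y - x) ≤ |y - x| := by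
    calc (n * (L : ℝ) ^ 2 / 2 - (halfRectN n L : ℝ)) * (y - x)
        ≤ |(n * (L : ℝ) ^ 2 / 2 - (halfRectN n L : ℝ)) * (y - x)| := le_abs_self _
      _ = (n * (L : ℝ) ^ 2 / 2 - (halfRectN n L : ℝ)) * |y - x| := by
          rw [abs_mul, abs_of_nonneg hδ0]
      _ ≤ 1 * |y - x| := mul_le_mul_of_nonneg_right hδ1.le (abs_nonneg _)
      _ = |y - x| := one_mul _
  rw [hchord]
  rw [hkR] at hdef
  have e : (K : ℝ) * K * x + (n * (L : ℝ) ^ 2 / 2 - (K : ℝ) * K * p) * (y - x) - |y - x| =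
      ((d : ℝ) * y + ((K : ℝ) * K - d) * x) +
        ((n * (L : ℝ) ^ 2 / 2 - ((K : ℝ) * K * p + d)) * (y - x) - |y - x|) := by ring
  rw [e]
  linarith

/-- **Interval-uniform coarse form of the chord**: for `2p/a² ≤ n ≤ 2(p+1)/a²` (`a ≥ 1`) the chord
parameter `λ = n a²/2 − p` lies in `[0, 1]`, so `min(log z_p, log z_q)/a² ≤ chord(n)` — ONE number below
the chord at every filling of the interval. [cite: Ruelle1969, §3.3 (3.16)–(3.18)] -/
theorem min_log_div_sq_le_chord {a p : ℕ} (ha : 1 ≤ a) {n : ℝ}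
    (hlo : 2 * (p : ℝ) / (a : ℝ) ^ 2 ≤ n) (hhi : n ≤ 2 * ((p : ℝ) + 1) / (a : ℝ) ^ 2) (zp zq : ℝ) :
    min (Real.log zp) (Real.log zq) / (a : ℝ) ^ 2 ≤
      (Real.log zp + (n * (a : ℝ) ^ 2 / 2 - p) * (Real.log zq - Real.log zp)) / (a : ℝ) ^ 2 := by
  have ha0 : (0 : ℝ) < (a : ℝ) := by exact_mod_cast ha
  have ha' : (0 : ℝ) < (a : ℝ) ^ 2 := by positivity
  refine div_le_div_of_nonneg_right ?_ ha'.le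
  rw [div_le_iff₀ ha'] at hlo
  rw [le_div_iff₀ ha'] at hhi
  have hl0 : 0 ≤ n * (a : ℝ) ^ 2 / 2 - p := by linarith
  have hl1 : n * (a : ℝ) ^ 2 / 2 - p ≤ 1 := by linarith
  set l := n * (a : ℝ) ^ 2 / 2 - p
  have e : Real.log zp + l * (Real.log zq - Real.log zp) = (1 - l) * Real.log zp + l * Real.log zq := by ring
  rw [e]
  have h1 : min (Real.log zp) (Real.log zq) ≤ Real.log zp := min_le_left _ _
  have h2 : min (Real.log zp) (Real.log zq) ≤ Real.log zq := min_le_right _ _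
  nlinarith [mul_le_mul_of_nonneg_left h1 (sub_nonneg.mpr hl1), mul_le_mul_of_nonneg_left h2 hl0]

end Chord

end Literature.MathematicalPhysics.QuantumLattice
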